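import Literature.MathematicalPhysics.QuantumLattice.HubbardTTPrimePhaseCoexistenceExclusionGrandCanonical
import Literature.MathematicalPhysics.QuantumLattice.HubbardFillingBoxChemicalPotentialCell
import Literature.MathematicalPhysics.QuantumLattice.CanonicalClassChemicalPotential
import HarnessLib

/-!
# The `T = 0` ENSEMBLE DICTIONARY AT THE LEVEL OF STATES for the 2D `t–t'` Hubbard model: a translation-invariant state of density
# `0 < ρ < 2` is a grand-canonical ground state of `H − μN` IF AND ONLY IF it is a canonical ground state at its density AND
# `μ ∈ [μ₋(ρ), μ₊(ρ)]`

Topic `Literature/MathematicalPhysics/QuantumLattice` (family `hubbard`; cell `pub/hubbard-downfold`, MO-S1 ↔ S2 seam «box ↦ one word», filling direction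
= the Legendre pair `μ ↔ n`; written 2026-08-28 by hubbard-downfold-unc-2 g22). The tree has the FUNCTION-level dictionary
`mem_Icc_chemPot_iff_isMinOn` (`μ ∈ [μ₋(n), μ₊(n)]` iff `n` minimises `x ↦ e(x) − μx` on `[0,2)`, `HubbardFillingBoxChemicalPotentialCell`), the
Lagrange-multiplier direction «canonical-class minimiser ⇒ grand-canonical minimiser for SOME `μ`» (`CanonicalClassChemicalPotential`) and the
Legendre step «grand-canonical ⇒ canonical at its density, `μ` a subgradient» (`TIDensityPhaseCoexistenceGrandCanonical`, g22). This file closes the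
square with the STATE-LEVEL equivalence, for `U ≥ 0`, any interaction `Γ` whose mean energy is `e_{Φ(t,t',U)} − μρ` (e.g.
`hubbardTTPrimeMuInteraction t t' U μ`, `gcInteractionTT' t t' U μ 0`) and any translation-invariant `ω` with `0 < ρ(ω) < 2`:

* `IsMeanEnergyMinimiser.meanEnergy_eq_energyDensityTT'_of_muShift` (⇒, energy half): `e_Φ(ω) = e(t,t',U; ρ(ω))`;
* `IsMeanEnergyMinimiser.chemPot_mem_Icc_of_muShift` (⇒, `μ` half): `μ ∈ [μ₋(ρ(ω)), μ₊(ρ(ω))]` (`chemPotMinusTT'`, `chemPotPlusTT'`) — interior densities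
  by the subgradient inequality, the endpoint `x = 0` of `[0,2)` by the one-sided continuity of a convex function at the end of a chord
  (`le_at_left_end_of_convexOn_of_forall_tangent`, §0);
* `isMeanEnergyMinimiser_of_meanEnergy_eq_of_chemPot_mem_Icc` (⇐): a canonical ground state at density `ρ` with `μ ∈ [μ₋(ρ), μ₊(ρ)]` minimises
  `e_Φ − μρ` over ALL translation-invariant states — those of density `0` or `2` included by MIXING them half-and-half with `ω` (the mixture
  has interior density, and mean energy / density are affine);
* **`isMeanEnergyMinimiser_iff_meanEnergy_eq_and_chemPot_mem_Icc`** — the equivalence; corollary `…_iff_of_isMeanEnergyMinimiser` («the set of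
  `μ` carrying a given grand-canonical ground state is exactly `[μ₋(ρ), μ₊(ρ)]`»).

USE: every canonical-class row of the tree (certified `e(n)` windows, `μ±` cells `chemPot_mem_cell_of_mem_Icc`) becomes a statement about the
grand-canonical ground states at explicit `μ`, and conversely. HONEST SCOPE: `T = 0`, translation-invariant mean-energy minimisers (Bratteli–
Kishimoto–Robinson's condition (2)); no existence statement (canonical ground states of every density exist in the tree,
`isLeast_meanEnergy_energyDensityTT'`); no number, no named fact, no definition. Everything is PROVED, 0 sorry.

## Mathlib / tree search
REUSED: `IsMeanEnergyMinimiser.meanEnergy_eq_tiGroundEnergyDensityAt_of_muShift`, `…tiGroundEnergyDensityAt_add_mul_sub_le_of_muShift`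
(`TIDensityPhaseCoexistenceGrandCanonical`); `tiGroundEnergyDensityAt_hubbardTTPrime_eq_energyDensityTT'`, `exists_isTranslationInvariant_density_eq`;
`convexOn_energyDensityTT'`; `le_chemPotPlusTT'_of_isMinOn`, `chemPotMinusTT'_le_of_isMinOn`, `energyDensityTT'_add_mul_le_of_mem_Icc`
(`HubbardFillingBoxChemicalPotentialCell`, `HubbardChemicalPotentialTL`); `IsTranslationInvariant.energyDensityTT'_le_meanEnergy`; `density_mix`, `meanEnergy_mix`,
`IsTranslationInvariant.mix`, `density_nonneg`, `density_le_two`. `lean search 'IsMeanEnergyMinimiser.*chemPot|chemPot.*iff.*Minimiser'` (2026-08-28): only the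
function-level iff and the ∃μ direction.

## References
* D. Ruelle, *Statistical Mechanics: Rigorous Results* (1969), §3.4 (equivalence of ensembles, the chemical potential). [cite: Ruelle1969, §3.4]
* O. Bratteli, A. Kishimoto, D. W. Robinson, Commun. Math. Phys. 64 (1978) 41, Thm. 2. [cite: BratteliKishimotoRobinson1978, Thm. 2 (condition 2)]
* E. H. Lieb, F. Y. Wu, Physica A 321 (2003) 1, §7 (`μ±`). [cite: LiebWuPhysicaA2003, §7]
* R. T. Rockafellar, *Convex Analysis* (1970), Thm. 24.1. [cite: Rockafellar1970, Thm. 24.1]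
-/

noncomputable section

open scoped ComplexOrder BigOperators

namespace Literature.MathematicalPhysics.QuantumLattice

open Matrix HubbardWave0 Literature.Probability.LatticeModels ThermodynamicLimit InfVolFermionState FermionInteraction Set

/-! ## §0 A convex function is bounded below at the END of a chord by every tangent line from the interior -/

/-- **Tangent lines reach the left endpoint.** If `f` is convex on `[0, 2)`, `0 < ρ < 2`, and the tangent inequality
`f ρ + μ(x − ρ) ≤ f x` holds for every `0 < x < 2`, then it also holds at `x = 0`: `f ρ − μρ ≤ f 0` (a convex function on a segment is
bounded below at the endpoint by the limit of its chords). [cite: Rockafellar1970, Thm. 24.1] -/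
theorem le_at_left_end_of_convexOn_of_forall_tangent {f : ℝ → ℝ} (hf : ConvexOn ℝ (Ico (0 : ℝ) 2) f) {ρ μ : ℝ} (hρ0 : 0 < ρ)
    (hρ2 : ρ < 2) (h : ∀ x : ℝ, 0 < x → x < 2 → f ρ + μ * (x - ρ) ≤ f x) :
    f ρ + μ * (0 - ρ) ≤ f 0 := by
  by_contra H
  have hg : 0 < f ρ - μ * ρ - f 0 := by linarith
  set g := f ρ - μ * ρ - f 0 with hg_def
  set K := (f ρ - f 0) / ρ - μ with hK_def
  -- for every `0 < x ≤ ρ`: `g ≤ x·K` (chord from `0` to `ρ` above `f x`, tangent below `f x`)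
  have key : ∀ x : ℝ, 0 < x → x ≤ ρ → g ≤ x * K := by
    intro x hx0 hxρ
    have hx2 : x < 2 := lt_of_le_of_lt hxρ hρ2
    have hb0 : 0 ≤ x / ρ := div_nonneg hx0.le hρ0.le
    have hb1 : x / ρ ≤ 1 := (div_le_one hρ0).2 hxρ
    have hJ := hf.2 (show (0 : ℝ) ∈ Ico (0 : ℝ) 2 from ⟨le_rfl, by norm_num⟩) (show ρ ∈ Ico (0 : ℝ) 2 from ⟨hρ0.le, hρ2⟩)
      (sub_nonneg.2 hb1) hb0 (by ring : 1 - x / ρ + x / ρ = 1)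
    simp only [smul_eq_mul, mul_zero, zero_add] at hJ
    have e1 : x / ρ * ρ = x := div_mul_cancel₀ x hρ0.ne'
    rw [e1] at hJ
    have ht := h x hx0 hx2
    -- `f ρ − μρ + μx ≤ f x ≤ (1 − x/ρ) f 0 + (x/ρ) f ρ`
    have e2 : x * K = x / ρ * (f ρ - f 0) - μ * x := by
      rw [hK_def, mul_sub, mul_comm x ((f ρ - f 0) / ρ), div_mul_eq_mul_div, mul_div_assoc, mul_comm (f ρ - f 0)]
      ring
    rw [e2, hg_def]
    nlinarith [hJ, ht]
  rcases le_or_gt K 0 with hK | hK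
  · have k := key ρ hρ0 le_rfl
    nlinarith [mul_nonpos_iff.2 (Or.inl ⟨hρ0.le, hK⟩)]
  · have hx0 : 0 < min ρ (g / (2 * K)) := lt_min hρ0 (div_pos hg (by linarith))
    have k := key (min ρ (g / (2 * K))) hx0 (min_le_left _ _)
    have k2 : min ρ (g / (2 * K)) * K ≤ g / (2 * K) * K := mul_le_mul_of_nonneg_right (min_le_right _ _) hK.le
    have e : g / (2 * K) * K = g / 2 := by field_simp
    rw [e] at k2
    linarith

namespace InfVolFermionState

variable (t t' : ℝ) {U : ℝ} (hU : 0 ≤ U) {Γ : FermionInteraction 2} {R' μ : ℝ} {ω : InfVolFermionState 2}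
include hU

/-! ## §1 Grand-canonical ⇒ canonical at its density, and `μ ∈ [μ₋(ρ), μ₊(ρ)]` -/

/-- **A grand-canonical ground state of the `t–t'` model is a canonical ground state at its density**: `e_Φ(ω) = e(t,t',U; ρ(ω))`
(`0 < ρ(ω) < 2`; `Γ` any interaction with `e_Γ = e_Φ − μρ`). [cite: Ruelle1969, §3.4] [cite: BratteliKishimotoRobinson1978, Thm. 2 (condition 2)] -/
theorem IsMeanEnergyMinimiser.meanEnergy_eq_energyDensityTT'_of_muShift (hω : ω.IsMeanEnergyMinimiser Γ R')
    (hΓ : ∀ σ : InfVolFermionState 2, σ.meanEnergy Γ R' = σ.meanEnergy (hubbardTTPrimeFermionInteraction t t' U) 1 - μ * σ.density)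
    (hρ0 : 0 < ω.density) (hρ2 : ω.density < 2) :
    ω.meanEnergy (hubbardTTPrimeFermionInteraction t t' U) 1 = energyDensityTT' t t' U ω.density := by
  rw [← tiGroundEnergyDensityAt_hubbardTTPrime_eq_energyDensityTT' t t' hU hρ0 hρ2]
  exact hω.meanEnergy_eq_tiGroundEnergyDensityAt_of_muShift _ 1 hΓ

/-- **The tangent inequality at every interior density**: `e(ρ(ω)) + μ(x − ρ(ω)) ≤ e(x)` for `0 < x < 2`. [cite: Ruelle1969, §3.4] -/
theorem IsMeanEnergyMinimiser.energyDensityTT'_add_mul_sub_le_of_muShift (hω : ω.IsMeanEnergyMinimiser Γ R')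
    (hΓ : ∀ σ : InfVolFermionState 2, σ.meanEnergy Γ R' = σ.meanEnergy (hubbardTTPrimeFermionInteraction t t' U) 1 - μ * σ.density)
    (hρ0 : 0 < ω.density) (hρ2 : ω.density < 2) {x : ℝ} (hx0 : 0 < x) (hx2 : x < 2) :
    energyDensityTT' t t' U ω.density + μ * (x - ω.density) ≤ energyDensityTT' t t' U x := by
  have h := hω.tiGroundEnergyDensityAt_add_mul_sub_le_of_muShift (hubbardTTPrimeFermionInteraction t t' U) 1 hΓ
    (exists_isTranslationInvariant_density_eq hx0 hx2)
  rwa [tiGroundEnergyDensityAt_hubbardTTPrime_eq_energyDensityTT' t t' hU hρ0 hρ2,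
    tiGroundEnergyDensityAt_hubbardTTPrime_eq_energyDensityTT' t t' hU hx0 hx2] at h

/-- **Grand-canonical ⇒ `μ ∈ [μ₋(ρ(ω)), μ₊(ρ(ω))]`**: the chemical potential of a `t–t'` grand-canonical ground state of interior density lies
in the `μ±`-cell of that density (`ρ(ω)` minimises `x ↦ e(x) − μx` on `[0,2)`; endpoint `0` by §0). [cite: LiebWuPhysicaA2003, §7] [cite: Ruelle1969, §3.4] -/
theorem IsMeanEnergyMinimiser.chemPot_mem_Icc_of_muShift (hω : ω.IsMeanEnergyMinimiser Γ R')
    (hΓ : ∀ σ : InfVolFermionState 2, σ.meanEnergy Γ R' = σ.meanEnergy (hubbardTTPrimeFermionInteraction t t' U) 1 - μ * σ.density)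
    (hρ0 : 0 < ω.density) (hρ2 : ω.density < 2) :
    μ ∈ Icc (chemPotMinusTT' t t' U ω.density) (chemPotPlusTT' t t' U ω.density) := by
  have hmin : IsMinOn (fun x => energyDensityTT' t t' U x - μ * x) (Ico (0 : ℝ) 2) ω.density := by
    intro x hx
    show energyDensityTT' t t' U ω.density - μ * ω.density ≤ energyDensityTT' t t' U x - μ * x
    rcases eq_or_lt_of_le hx.1 with h0 | hx0
    · have h := le_at_left_end_of_convexOn_of_forall_tangent (convexOn_energyDensityTT' t t' hU) hρ0 hρ2
        (fun y hy0 hy2 => hω.energyDensityTT'_add_mul_sub_le_of_muShift t t' hU hΓ hρ0 hρ2 hy0 hy2)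
      rw [← h0]
      linarith
    · have h := hω.energyDensityTT'_add_mul_sub_le_of_muShift t t' hU hΓ hρ0 hρ2 hx0 hx.2
      linarith
  exact ⟨chemPotMinusTT'_le_of_isMinOn t t' hU hρ0 hρ2 hmin, le_chemPotPlusTT'_of_isMinOn t t' hU hρ0 hρ2 hmin⟩

/-! ## §2 Canonical at its density with `μ ∈ [μ₋(ρ), μ₊(ρ)]` ⇒ grand-canonical -/

/-- **Canonical ground state + `μ` in the cell ⇒ grand-canonical ground state.** A translation-invariant `ω` with `0 < ρ(ω) < 2`,
`e_Φ(ω) = e(ρ(ω))` and `μ ∈ [μ₋(ρ(ω)), μ₊(ρ(ω))]` minimises `e_Γ = e_Φ − μρ` over ALL translation-invariant states: one of interior density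
obeys `e_Φ(σ) ≥ e(ρ(σ)) ≥ e(ρ(ω)) + μ(ρ(σ) − ρ(ω))`; one of density `0` or `2` is first MIXED half-and-half with `ω`.
[cite: Ruelle1969, §3.4] [cite: LiebWuPhysicaA2003, §7] -/
theorem isMeanEnergyMinimiser_of_meanEnergy_eq_of_chemPot_mem_Icc (hω : ω.IsTranslationInvariant)
    (hΓ : ∀ σ : InfVolFermionState 2, σ.meanEnergy Γ R' = σ.meanEnergy (hubbardTTPrimeFermionInteraction t t' U) 1 - μ * σ.density)
    (hρ0 : 0 < ω.density) (hρ2 : ω.density < 2)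
    (he : ω.meanEnergy (hubbardTTPrimeFermionInteraction t t' U) 1 = energyDensityTT' t t' U ω.density)
    (hμ : μ ∈ Icc (chemPotMinusTT' t t' U ω.density) (chemPotPlusTT' t t' U ω.density)) :
    ω.IsMeanEnergyMinimiser Γ R' := by
  -- interior densities
  have interior : ∀ σ : InfVolFermionState 2, σ.IsTranslationInvariant → 0 < σ.density → σ.density < 2 →
      ω.meanEnergy Γ R' ≤ σ.meanEnergy Γ R' := by
    intro σ hσ hσ0 hσ2
    rw [hΓ, hΓ, he]
    have h1 := hσ.energyDensityTT'_le_meanEnergy t t' hU hσ0 hσ2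
    have h2 := energyDensityTT'_add_mul_le_of_mem_Icc t t' hU hρ0 hρ2 hμ.1 hμ.2 hσ0.le hσ2
    linarith
  refine ⟨hω, fun σ hσ => ?_⟩
  -- mix `σ` with `ω`: the mixture has interior density
  have hmTI := hσ.mix hω (1 / 2) (by norm_num) (by norm_num)
  have hmρ : (InfVolFermionState.mix (1 / 2) (by norm_num) (by norm_num) σ ω).density = (1 / 2) * σ.density + (1 / 2) * ω.density := by
    rw [density_mix]; ring
  have hσnn := σ.density_nonneg
  have hσ2 := σ.density_le_two
  have hm0 : 0 < (InfVolFermionState.mix (1 / 2) (by norm_num) (by norm_num) σ ω).density := by rw [hmρ]; linarith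
  have hm2 : (InfVolFermionState.mix (1 / 2) (by norm_num) (by norm_num) σ ω).density < 2 := by rw [hmρ]; linarith
  have h := interior _ hmTI hm0 hm2
  rw [meanEnergy_mix] at h
  linarith

/-! ## §3 The equivalence -/

/-- **THE STATE-LEVEL ENSEMBLE DICTIONARY (`T = 0`, 2D `t–t'` Hubbard model, `U ≥ 0`).** For a translation-invariant `ω` with `0 < ρ(ω) < 2`
and any `Γ` with `e_Γ = e_Φ − μρ`: `ω` is a grand-canonical ground state of `H − μN` (a translation-invariant mean-energy minimiser of `Γ`)
IFF `ω` is a canonical ground state at its own density (`e_Φ(ω) = e(t,t',U; ρ(ω))`) AND `μ ∈ [μ₋(ρ(ω)), μ₊(ρ(ω))]`.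
[cite: Ruelle1969, §3.4] [cite: BratteliKishimotoRobinson1978, Thm. 2 (condition 2)] [cite: LiebWuPhysicaA2003, §7] -/
theorem isMeanEnergyMinimiser_iff_meanEnergy_eq_and_chemPot_mem_Icc (hω : ω.IsTranslationInvariant)
    (hΓ : ∀ σ : InfVolFermionState 2, σ.meanEnergy Γ R' = σ.meanEnergy (hubbardTTPrimeFermionInteraction t t' U) 1 - μ * σ.density)
    (hρ0 : 0 < ω.density) (hρ2 : ω.density < 2) :
    ω.IsMeanEnergyMinimiser Γ R' ↔
      ω.meanEnergy (hubbardTTPrimeFermionInteraction t t' U) 1 = energyDensityTT' t t' U ω.density ∧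
        μ ∈ Icc (chemPotMinusTT' t t' U ω.density) (chemPotPlusTT' t t' U ω.density) :=
  ⟨fun h => ⟨h.meanEnergy_eq_energyDensityTT'_of_muShift t t' hU hΓ hρ0 hρ2, h.chemPot_mem_Icc_of_muShift t t' hU hΓ hρ0 hρ2⟩,
    fun h => isMeanEnergyMinimiser_of_meanEnergy_eq_of_chemPot_mem_Icc t t' hU hω hΓ hρ0 hρ2 h.1 h.2⟩

variable {Γ' : FermionInteraction 2} {R'' μ' : ℝ}

/-- **The set of chemical potentials carrying a given grand-canonical ground state is the whole cell `[μ₋(ρ), μ₊(ρ)]`.** If `ω` is a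
grand-canonical ground state at `μ` (interior density), then for every `μ'`: `ω` is a grand-canonical ground state at `μ'` iff
`μ' ∈ [μ₋(ρ(ω)), μ₊(ρ(ω))]` — e.g. a half-filled ground state of a Mott insulator is a grand-canonical ground state for every `μ'` in the
charge gap `[μ₋(1), μ₊(1)]`. [cite: LiebWuPhysicaA2003, §7] [cite: Ruelle1969, §3.4] -/
theorem IsMeanEnergyMinimiser.isMeanEnergyMinimiser_iff_chemPot_mem_Icc (hω : ω.IsMeanEnergyMinimiser Γ R')
    (hΓ : ∀ σ : InfVolFermionState 2, σ.meanEnergy Γ R' = σ.meanEnergy (hubbardTTPrimeFermionInteraction t t' U) 1 - μ * σ.density)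
    (hΓ' : ∀ σ : InfVolFermionState 2, σ.meanEnergy Γ' R'' = σ.meanEnergy (hubbardTTPrimeFermionInteraction t t' U) 1 - μ' * σ.density)
    (hρ0 : 0 < ω.density) (hρ2 : ω.density < 2) :
    ω.IsMeanEnergyMinimiser Γ' R'' ↔ μ' ∈ Icc (chemPotMinusTT' t t' U ω.density) (chemPotPlusTT' t t' U ω.density) := by
  have he := hω.meanEnergy_eq_energyDensityTT'_of_muShift t t' hU hΓ hρ0 hρ2
  rw [isMeanEnergyMinimiser_iff_meanEnergy_eq_and_chemPot_mem_Icc t t' hU hω.1 hΓ' hρ0 hρ2]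
  exact ⟨fun h => h.2, fun h => ⟨he, h⟩⟩

/-- **The `t–t'` `μ`-pencil instance**: `ω` (translation invariant, `0 < ρ(ω) < 2`) is a grand-canonical ground state of
`hubbardTTPrimeMuInteraction t t' U μ` iff it is a canonical ground state at its density and `μ ∈ [μ₋(ρ(ω)), μ₊(ρ(ω))]`.
[cite: Ruelle1969, §3.4] [cite: LiebWuPhysicaA2003, §7] -/
theorem isMeanEnergyMinimiser_hubbardTTPrimeMu_iff (hω : ω.IsTranslationInvariant) (hρ0 : 0 < ω.density) (hρ2 : ω.density < 2) :
    ω.IsMeanEnergyMinimiser (hubbardTTPrimeMuInteraction t t' U μ) 1 ↔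
      ω.meanEnergy (hubbardTTPrimeFermionInteraction t t' U) 1 = energyDensityTT' t t' U ω.density ∧
        μ ∈ Icc (chemPotMinusTT' t t' U ω.density) (chemPotPlusTT' t t' U ω.density) :=
  isMeanEnergyMinimiser_iff_meanEnergy_eq_and_chemPot_mem_Icc t t' hU hω (meanEnergy_hubbardTTPrimeMu_eq_sub t t' U μ) hρ0 hρ2

end InfVolFermionState

end Literature.MathematicalPhysics.QuantumLattice

end
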